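import Summits.CriticalPhenomena.PercolationContinuityZ3.Theorems.PercNearOneGluingNoHeavyLowerTailThreePointRowsLeFive

/-!
# `NoHeavyLowerTail` (crux stmt-CriticalPhenomena-4575): the four-point sunflower rows `G₄ = SF3-G4`, `F₄` and `H₄ = (Q+R)·AG₄ − e₃` hold on
# every weighted graph with at most five vertices — kernel-checked, three-copy fibrewise (Richards-comb) positive

Support file (certificate seat `prim-cert-2`; `--supports stmt-CriticalPhenomena-4575`; COMPUTATIONAL: the `checkC` evaluations use `native_decide`).

Four terminals `a b c d`; the sunflower cells of their connection pattern (run/shared/lean/ttrl/sahi/README RESULT 4): `Q` = all four separated,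
`x₁, x₂, x₃` = the three PETALS (the pattern refines the matching `ab|cd`, `ac|bd`, `ad|bc` respectively and is not discrete: the matching itself or
the single pair inside it), `R` = some block of size `≥ 3` (so `Q + x₁ + x₂ + x₃ + R = 1`); `e₂ = x₁x₂ + x₁x₃ + x₂x₃`, `e₃ = x₁x₂x₃`,
`AG₄ = Q·R − e₂` (Gladkov's sunflower inequality, proved).  The factory rows

  `H₄ := (Q + R)·AG₄ − e₃ ≥ 0`   ⟹   `G₄ = SF3-G4 := AG₄ − e₃ ≥ 0`   ⟹   `F₄ := (1 + R)·AG₄ − e₃ ≥ 0`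

(0 violations in ttrl2's censuses; `G₄`, `SF3-Hmax` are used as census-validated CONDITIONAL rows) are, like their three-point analogues
(`…ThreePointRowsLeFive`), three-copy comb positive on `K₄` and `K₅` (all `4^m` tensor-Bernstein fibre sums `≥ 0`; the `H_max` branches
`Q·AG₄ − e₃` (≡ 0 on four vertices, negative fibres on `K₅`) and `R·AG₄ − e₃` (negative fibres on `K₄`) are not).

**Theorem `fourRowHolds_le_five`.**  For `i ∈ {0,1,2}` (`H₄, G₄, F₄`), every `n ≤ 5`, every `w : Sym2 (Fin n) → [0,1]` and all pairwise distinct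
`a b c d : Fin n`: `0 ≤ cval w (fourTerms i (a,b,c,d))` (the signed cubic form of the row in `prodBernoulli w`-probabilities of the cell events;
`connEvent` predicates `p4Q`, `p4R`, `p4X₁..₃`).  Proof: `checkC` at the standard quadruple of `K₄`, `K₅` (`native_decide`) + relabel transport.
-/

namespace Summit.CriticalPhenomena.PercolationContinuityZ3.Theorems.E3GroupSepCert

open Finset MeasureTheory OneCutCert CovTransferCert
open scoped BigOperators
open Literature.Probability.Percolation Literature.Probability.LatticeModels

variable {n : ℕ}

/-! ## The sunflower cells of four terminals -/

/-- `Q`: the four terminals are pairwise separated. [this work] -/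
def p4Q (a b c d : Fin n) : CRel n → Bool := fun r => !(r a b) && !(r a c) && !(r a d) && !(r b c) && !(r b d) && !(r c d)
/-- `R`: some three of the four terminals are joined. [this work] -/
def p4R (a b c d : Fin n) : CRel n → Bool := fun r =>
  (r a b && r a c) || (r a b && r a d) || (r a c && r a d) || (r b c && r b d)
/-- Petal `x₁` (matching `ab|cd`): no connection across the matching, and `a ↔ b` or `c ↔ d`. [this work] -/
def p4X₁ (a b c d : Fin n) : CRel n → Bool := fun r => !(r a c) && !(r a d) && !(r b c) && !(r b d) && (r a b || r c d)
/-- Petal `x₂` (matching `ac|bd`). [this work] -/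
def p4X₂ (a b c d : Fin n) : CRel n → Bool := fun r => !(r a b) && !(r a d) && !(r c b) && !(r c d) && (r a c || r b d)
/-- Petal `x₃` (matching `ad|bc`). [this work] -/
def p4X₃ (a b c d : Fin n) : CRel n → Bool := fun r => !(r a b) && !(r a c) && !(r d b) && !(r d c) && (r a d || r b c)

/-- A terminal quadruple. [this work] -/
abbrev Quad (n : ℕ) : Type := Fin n × Fin n × Fin n × Fin n

/-- The cubic terms of the rows at `t = (a,b,c,d)`: `0 = H₄ = (Q+R)(QR − e₂) − e₃`, `1 = G₄ = QR − e₂ − e₃`, `2 = F₄ = (1+R)(QR − e₂) − e₃`.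
[this work] -/
def fourTerms (i : Fin 3) (t : Quad n) : List (CTerm n) :=
  let Q := p4Q t.1 t.2.1 t.2.2.1 t.2.2.2
  let R := p4R t.1 t.2.1 t.2.2.1 t.2.2.2
  let X₁ := p4X₁ t.1 t.2.1 t.2.2.1 t.2.2.2
  let X₂ := p4X₂ t.1 t.2.1 t.2.2.1 t.2.2.2
  let X₃ := p4X₃ t.1 t.2.1 t.2.2.1 t.2.2.2
  match i with
  | 0 => [(1, Q, R, Q), (1, Q, R, R), (-1, X₁, X₂, Q), (-1, X₁, X₃, Q), (-1, X₂, X₃, Q), (-1, X₁, X₂, R), (-1, X₁, X₃, R), (-1, X₂, X₃, R),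
      (-1, X₁, X₂, X₃)]
  | 1 => [(1, Q, R, pTrue), (-1, X₁, X₂, pTrue), (-1, X₁, X₃, pTrue), (-1, X₂, X₃, pTrue), (-1, X₁, X₂, X₃)]
  | 2 => [(1, Q, R, pTrue), (1, Q, R, R), (-1, X₁, X₂, pTrue), (-1, X₁, X₃, pTrue), (-1, X₂, X₃, pTrue), (-1, X₁, X₂, R), (-1, X₁, X₃, R),
      (-1, X₂, X₃, R), (-1, X₁, X₂, X₃)]

/-- Row `i` holds at `(w, t)`. [this work] -/
def FourRowHolds (i : Fin 3) (w : Sym2 (Fin n) → unitInterval) (t : Quad n) : Prop := 0 ≤ cval w (fourTerms i t)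

/-! ## Transport along relabellings -/

/-- A quadruple relabelled. [this work] -/
def quadmap (τ : Fin n ≃ Fin n) (t : Quad n) : Quad n := (τ t.1, τ t.2.1, τ t.2.2.1, τ t.2.2.2)

/-- `quadmap σ.symm ∘ quadmap σ = id`. [this work] -/
theorem quadmap_symm_quadmap (σ : Fin n ≃ Fin n) (t : Quad n) : quadmap σ.symm (quadmap σ t) = t := by
  obtain ⟨a, b, c, d⟩ := t
  simp [quadmap]

/-- The row terms under relabelling. [this work] -/
theorem fourTerms_relP (i : Fin 3) (τ : Fin n ≃ Fin n) (t : Quad n) :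
    ((fourTerms i t).map fun x => (x.1, relP τ x.2.1, relP τ x.2.2.1, relP τ x.2.2.2)) = fourTerms i (quadmap τ t) := by
  obtain ⟨a, b, c, d⟩ := t
  fin_cases i <;> rfl

/-- **A row is transported along a relabelling of the vertices.** [this work] -/
theorem fourRowHolds_relabel (i : Fin 3) (σ : Fin n ≃ Fin n) (w : Sym2 (Fin n) → unitInterval) (t : Quad n)
    (h : FourRowHolds i w t) : FourRowHolds i (relabelW σ w) (quadmap σ t) := by
  unfold FourRowHolds at h ⊢
  rw [cval_map_relP, fourTerms_relP, quadmap_symm_quadmap]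
  exact h

/-- A row at all weights for a quadruple gives it at all weights for every relabelled quadruple. [this work] -/
theorem fourRowHolds_forall_relabel (i : Fin 3) (σ : Fin n ≃ Fin n) {t : Quad n}
    (h : ∀ w : Sym2 (Fin n) → unitInterval, FourRowHolds i w t) (w : Sym2 (Fin n) → unitInterval) :
    FourRowHolds i w (quadmap σ t) := by
  have hw : relabelW σ (fun e => w (sym2Equiv σ e)) = w := by
    funext e
    unfold relabelW
    simp only [Equiv.apply_symm_apply]
  rw [← hw]
  exact fourRowHolds_relabel i σ _ t (h _)

/-! ## Distinct quadruples and the evaluations -/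

/-- All quadruples of `Fin n`. [this work] -/
def allQuad (n : ℕ) : List (Quad n) :=
  (List.finRange n).flatMap fun a => (List.finRange n).flatMap fun b => (List.finRange n).flatMap fun c =>
    (List.finRange n).map fun d => (a, b, c, d)

/-- Every quadruple is listed. [this work] -/
theorem mem_allQuad (a b c d : Fin n) : (a, b, c, d) ∈ allQuad n := by
  simp [allQuad, List.mem_flatMap, List.mem_map]

/-- Quadruples with pairwise distinct entries. [this work] -/
def distinctQuad (n : ℕ) : List (Quad n) := (allQuad n).filter fun t =>
  decide (t.1 ≠ t.2.1 ∧ t.1 ≠ t.2.2.1 ∧ t.1 ≠ t.2.2.2 ∧ t.2.1 ≠ t.2.2.1 ∧ t.2.1 ≠ t.2.2.2 ∧ t.2.2.1 ≠ t.2.2.2)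

/-- A pairwise distinct quadruple is listed. [this work] -/
theorem mem_distinctQuad {a b c d : Fin n} (hab : a ≠ b) (hac : a ≠ c) (had : a ≠ d) (hbc : b ≠ c) (hbd : b ≠ d) (hcd : c ≠ d) :
    (a, b, c, d) ∈ distinctQuad n := by
  unfold distinctQuad
  rw [List.mem_filter]
  exact ⟨mem_allQuad a b c d, by simp [hab, hac, had, hbc, hbd, hcd]⟩

/-- The standard quadruple. [this work] -/
def quad₀ (n : ℕ) (h : 4 ≤ n) : Quad n := (⟨0, by omega⟩, ⟨1, by omega⟩, ⟨2, by omega⟩, ⟨3, by omega⟩)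

/-- Cover of the distinct quadruples of `Fin 4`. [this work] -/
theorem cover_quad4 : ∀ t ∈ distinctQuad 4, ∃ σ : Equiv.Perm (Fin 4), quadmap σ (quad₀ 4 le_rfl) = t := by native_decide
/-- Cover of the distinct quadruples of `Fin 5`. [this work] -/
theorem cover_quad5 : ∀ t ∈ distinctQuad 5, ∃ σ : Equiv.Perm (Fin 5), quadmap σ (quad₀ 5 (by norm_num)) = t := by native_decide

/-- `K₄`: the three rows pass the three-copy check at the standard quadruple (base `2^23`). [this work] -/
theorem checkQuad4 (i : Fin 3) : checkC 4 23 (fourTerms i (quad₀ 4 le_rfl)) = true := by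
  fin_cases i <;> native_decide
/-- `K₅`: the three rows pass the three-copy check at the standard quadruple (base `2^35`). [this work] -/
theorem checkQuad5 (i : Fin 3) : checkC 5 35 (fourTerms i (quad₀ 5 (by norm_num))) = true := by
  fin_cases i <;> native_decide

/-- The rows on `Fin 4`. [this work] -/
theorem fourRowHolds_four (i : Fin 3) (w : Sym2 (Fin 4) → unitInterval) (a b c d : Fin 4) (hab : a ≠ b) (hac : a ≠ c) (had : a ≠ d)
    (hbc : b ≠ c) (hbd : b ≠ d) (hcd : c ≠ d) : FourRowHolds i w (a, b, c, d) := by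
  obtain ⟨σ, hσ⟩ := cover_quad4 _ (mem_distinctQuad hab hac had hbc hbd hcd)
  rw [← hσ]
  exact fourRowHolds_forall_relabel i σ (fun w' => checkC_sound 23 _ (checkQuad4 i) w') w

/-- The rows on `Fin 5`. [this work] -/
theorem fourRowHolds_five (i : Fin 3) (w : Sym2 (Fin 5) → unitInterval) (a b c d : Fin 5) (hab : a ≠ b) (hac : a ≠ c) (had : a ≠ d)
    (hbc : b ≠ c) (hbd : b ≠ d) (hcd : c ≠ d) : FourRowHolds i w (a, b, c, d) := by
  obtain ⟨σ, hσ⟩ := cover_quad5 _ (mem_distinctQuad hab hac had hbc hbd hcd)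
  rw [← hσ]
  exact fourRowHolds_forall_relabel i σ (fun w' => checkC_sound 35 _ (checkQuad5 i) w') w

/-- **The three four-point rows on every weighted graph with at most five vertices**, for all pairwise distinct terminals. [this work] -/
theorem fourRowHolds_le_five (i : Fin 3) : ∀ n ≤ 5, ∀ (w : Sym2 (Fin n) → unitInterval) (a b c d : Fin n),
    a ≠ b → a ≠ c → a ≠ d → b ≠ c → b ≠ d → c ≠ d → FourRowHolds i w (a, b, c, d) := by
  intro n hn w a b c d hab hac had hbc hbd hcd
  have hcard : 4 ≤ n := by
    have h := Finset.card_le_univ ({a, b, c, d} : Finset (Fin n))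
    rw [Fintype.card_fin] at h
    have h4 : ({a, b, c, d} : Finset (Fin n)).card = 4 := by
      rw [Finset.card_insert_of_notMem (by simp [hab, hac, had]), Finset.card_insert_of_notMem (by simp [hbc, hbd]),
        Finset.card_pair hcd]
    omega
  interval_cases n <;> try omega
  · exact fourRowHolds_four i w a b c d hab hac had hbc hbd hcd
  · exact fourRowHolds_five i w a b c d hab hac had hbc hbd hcd

/-! ## The rows in probability notation -/

section Statements

variable (w : Sym2 (Fin n) → unitInterval) (a b c d : Fin n)

/-- `Q`. [this work] -/
noncomputable def l4Q : ℝ := (prodBernoulli w).real (connEvent (p4Q a b c d))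
/-- `R`. [this work] -/
noncomputable def l4R : ℝ := (prodBernoulli w).real (connEvent (p4R a b c d))
/-- `x₁`. [this work] -/
noncomputable def l4X₁ : ℝ := (prodBernoulli w).real (connEvent (p4X₁ a b c d))
/-- `x₂`. [this work] -/
noncomputable def l4X₂ : ℝ := (prodBernoulli w).real (connEvent (p4X₂ a b c d))
/-- `x₃`. [this work] -/
noncomputable def l4X₃ : ℝ := (prodBernoulli w).real (connEvent (p4X₃ a b c d))

end Statements

/-- **`H₄ = (Q+R)·AG₄ − e₃ ≥ 0` on at most five vertices.** [this work] -/
theorem h4_le_five : ∀ n ≤ 5, ∀ (w : Sym2 (Fin n) → unitInterval) (a b c d : Fin n), a ≠ b → a ≠ c → a ≠ d → b ≠ c → b ≠ d → c ≠ d →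
    0 ≤ (l4Q w a b c d + l4R w a b c d) * (l4Q w a b c d * l4R w a b c d -
      (l4X₁ w a b c d * l4X₂ w a b c d + l4X₁ w a b c d * l4X₃ w a b c d + l4X₂ w a b c d * l4X₃ w a b c d)) -
      l4X₁ w a b c d * l4X₂ w a b c d * l4X₃ w a b c d := by
  intro n hn w a b c d hab hac had hbc hbd hcd
  have h := fourRowHolds_le_five 0 n hn w a b c d hab hac had hbc hbd hcd
  unfold FourRowHolds cval fourTerms at h
  simp only [List.map_cons, List.map_nil, List.sum_cons, List.sum_nil] at h
  unfold pr at h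
  unfold l4Q l4R l4X₁ l4X₂ l4X₃
  push_cast at h
  linarith

/-- **`G₄ = SF3-G4 = Q·R − e₂ − e₃ ≥ 0` on at most five vertices.** [this work] -/
theorem g4_le_five : ∀ n ≤ 5, ∀ (w : Sym2 (Fin n) → unitInterval) (a b c d : Fin n), a ≠ b → a ≠ c → a ≠ d → b ≠ c → b ≠ d → c ≠ d →
    l4X₁ w a b c d * l4X₂ w a b c d + l4X₁ w a b c d * l4X₃ w a b c d + l4X₂ w a b c d * l4X₃ w a b c d +
        l4X₁ w a b c d * l4X₂ w a b c d * l4X₃ w a b c d ≤ l4Q w a b c d * l4R w a b c d := by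
  intro n hn w a b c d hab hac had hbc hbd hcd
  have h := fourRowHolds_le_five 1 n hn w a b c d hab hac had hbc hbd hcd
  unfold FourRowHolds cval fourTerms at h
  simp only [List.map_cons, List.map_nil, List.sum_cons, List.sum_nil, pr_pTrue] at h
  unfold pr at h
  unfold l4Q l4R l4X₁ l4X₂ l4X₃
  push_cast at h
  linarith

/-- **`F₄ = (1+R)·AG₄ − e₃ ≥ 0` on at most five vertices.** [this work] -/
theorem f4_le_five : ∀ n ≤ 5, ∀ (w : Sym2 (Fin n) → unitInterval) (a b c d : Fin n), a ≠ b → a ≠ c → a ≠ d → b ≠ c → b ≠ d → c ≠ d →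
    0 ≤ (1 + l4R w a b c d) * (l4Q w a b c d * l4R w a b c d -
      (l4X₁ w a b c d * l4X₂ w a b c d + l4X₁ w a b c d * l4X₃ w a b c d + l4X₂ w a b c d * l4X₃ w a b c d)) -
      l4X₁ w a b c d * l4X₂ w a b c d * l4X₃ w a b c d := by
  intro n hn w a b c d hab hac had hbc hbd hcd
  have h := fourRowHolds_le_five 2 n hn w a b c d hab hac had hbc hbd hcd
  unfold FourRowHolds cval fourTerms at h
  simp only [List.map_cons, List.map_nil, List.sum_cons, List.sum_nil, pr_pTrue] at h
  unfold pr at h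
  unfold l4Q l4R l4X₁ l4X₂ l4X₃
  push_cast at h
  linarith

end Summit.CriticalPhenomena.PercolationContinuityZ3.Theorems.E3GroupSepCert
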